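/-
Copyright (c) 2026 the pub-hodgecm-mathlib formalisation cell (harness21).  Prover seat hodgecm-mathlib-K2E1-p11 (g6), Track B ∕ K2-LIT, h413 = `stmt-HodgeConjecture-24833`,
R90-TF section S8 «ContSpec-n½», the `hsrc` supplier estate (S8 dealer R90-CS-plan (g3), S8-R240 (2) «`K2E1ChiMidBlockUnfoldingLetterFreeU3` — bind ★ (3)(ii) p864759 + ★ (3)(iii)
p864765 into the `hΩ` core of ★ p864821 `hsrc_of_record_at_basePoint_of_core`»; census `R90/S8/CENSUS-UnfoldingLetterFree.K2E1-p11-g6.md` f7bfa6fc755d5846): THE GLOBAL ASSEMBLY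
OF THE PURE-TENSOR READING — the finite-level witness section READ ON ANY finite-adelic point from its LOCAL Iwasawa data, place by place; and the bad-place local reading of a LOWER
UNITRIANGULAR component through ★ (E-cell).
-/
import Summits.HodgeConjecture.HodgeConjecture.Theorems.K2E1FinAdelicBorelLevelLocalGlobalU3        -- ★ p864759 (K2E1-p14 (g5)) (3)(ii): `exists_borel_mul_level_evalPlace_eq`, `forall_ne_borel_mul_level_iff_exists_place`
import Summits.HodgeConjecture.HodgeConjecture.Theorems.K2E1ChiBorelCharacterLocalFactorisationU3   -- ★ p864765 (K2E1-p11 (g5)) (3)(iii): `borelCharacter_finAdelicToAdelic_eq_finprod_of_apply_eq`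
import Summits.HodgeConjecture.HodgeConjecture.Theorems.K2E1BigCellConjugateCongruenceU3           -- ★ (E-cell) (R90-CS-p03 (g3)): `lowerUnitriangular_mem_valuedCongruenceSubgroup`, `valuation_le_of_upperTriangular_mul_lowerUnitriangular_mem`
import HarnessLib

/-!
# K2·E1 ∕ R90·S8 — `K2E1ChiMidBlockUnfoldingLetterFreeU3`: THE PURE-TENSOR READING `hΩ` OF THE FINITE-LEVEL WITNESS SECTION, ASSEMBLED FROM LOCAL IWASAWA DATA
# ((3)(i) global plumbing ∘ ★ (3)(ii) local–global Borel bridge ∘ ★ (3)(iii) character factorisation), AND THE BAD-PLACE LOCAL READING THROUGH ★ (E-cell)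

Cell `pub/hodgecm-mathlib`, crux h413 = `stmt-HodgeConjecture-24833`, route of record `HCCMUnconditional`; R90-TF section S8 «ContSpec-n½», road R2-χ₃ ((V)∕(R)′ OF RECORD row `hsrc`; ★ p864821
`K2E1ChiMidBlockUnfoldingOfRecordU3.hsrc_of_record_at_basePoint_of_core` binds, around its pure-tensor letter, FIVE things: a local weight family `ω`, its shape letters `hωc hω1 hωS₀`, the
reading `hΩ : ∀ x, Φ_f((ι(w₀)·u((0,X_f(x)),θ(0,x₂)))_f·b₁) = ∏ᶠ_v ω_v(x_v)`, and the tokens `hin hsp` stated for that `ω` — and `ω` never reaches its conclusion).  THEOREMS ONLY (no `def`, no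
`instance`, no `notation`, no named-fact hypothesis, no `sorry`; default heartbeats); lane `--supports stmt-HodgeConjecture-24833 --as helper` (count-neutral).  Closes no socket.

THE MATHEMATICS ([BorelJacquet1979] §4.1; [PlatonovRapinchuk1994] §5.1; [TateThesis1967] §3.2 Lemma 3.2.1, §4.3; [MoeglinWaldspurger1995] I.2.17, II.1.6; [BushnellHenniart2006] §7.1, §12.4).
Let `Φ_f : U(2,1)(𝔸_{L⁺,f}) → ℂ` be a FINITE-LEVEL SECTION of the single-character block `(χ₁, 1)` at the principal level `K_f(𝔫)` in the sense of ★ (E-supp) `R90.S8.exists_finLevelSection_with_support`: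
(supp-on) `Φ_f(b·k) = χ₁((ι_f b)₀₀)·𝟙((ι_f b)₁₁)` for `ι_f b ∈ B(𝔸)`, `k ∈ K_f(𝔫)`, and (supp-off) `Φ_f(u) = 0` for `u ∉ B_f·K_f(𝔫)`.  For ANY `u ∈ U(2,1)(𝔸_{L⁺,f})`:
(§1, «on») if at EVERY finite place `v` of `L⁺` one has local Iwasawa data `u_v = β_v·κ_v` in `U(2,1)(L⁺_v)` — `β_v` upper triangular at every `w ∣ v`, `(κ_v)_w ∈ K_w(|𝔫|_w)` — then the
restricted-product assembly ★ (3)(ii) `exists_borel_mul_level_evalPlace_eq` (K2E1-p14) produces GLOBAL `b, k` with `u = b·k`, `ι_f b ∈ B(𝔸)`, `k ∈ K_f(𝔫)` and `b_v = β_v`; (supp-on) gives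
`Φ_f(u) = χ₁((ι_f b)₀₀)`, and ★ (3)(iii) `borelCharacter_finAdelicToAdelic_eq_finprod_of_apply_eq` (K2E1-p11 (g5); Tate's finite-idele Euler factorisation) reads this as
**`Φ_f(u) = ∏ᶠ_v ∏_{w ∣ v} χ₁,w(((β_v)_w)₀₀)`** — the local `(0,0)`-entries `((β_v)_w)₀₀ ∈ L_w^×` of the CHOSEN local Borel factors (units: an invertible upper-triangular matrix has
non-zero diagonal); («off») if at SOME place `u_v ∉ B_v·K_v(𝔫)` then ★ (3)(ii)'s (supp-off) twin gives `u ∉ B_f·K_f(𝔫)` and `Φ_f(u) = 0`.  (§2) Hence, for ANY parametrised family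
`x ↦ U(x) ∈ U(2,1)(𝔸_{L⁺,f})` and ANY weight family `ω_v : (L⁺_v)³ → ℂ`, PER-PLACE READINGS «either `U(x)_v = β·κ` as above with `ω_v(x_v) = ∏_{w∣v} χ₁,w((β_w)₀₀)`, or `U(x)_v` off
`B_v·K_v(𝔫)` with `ω_v(x_v) = 0` (and then finitely many `ω_v(x_v) ≠ 1`)» give the PURE-TENSOR READING **`∀ x, Φ_f(U x) = ∏ᶠ_v ω_v(x_v)`** — ★ p864821's letter `hΩ` IN ITS BYTES once
`U x := (ι(w₀)·u((0,X_f(x)),θ(0,x₂)))_f·b₁` (and, verbatim, K2E1-p14's `hΩ_k` at `u(x)·k_f` for `k ∈ K_max`).  (§3) THE BAD-PLACE LOCAL READING: if the `w`-components of `u_v` are LOWER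
UNITRIANGULAR `(1 0 0; a_w 1 0; b_w d_w 1)` (the shape of `(w₀·u(X,Z)·w₀)_w = n⁻(−σX_w, Z_w, X_w)`, ★ (E-cell) §1) and `|𝔫|_w < 1` for every `w ∣ v`, then ★ (E-cell) §2 gives: all
`|a_w|, |b_w|, |d_w| ≤ |𝔫|_w` ⇒ the «on» reading holds WITH `β_v = 1` (so the local character factor is `∏_w χ₁,w(1) = 1`); some valuation `> |𝔫|_w` ⇒ the «off» reading holds.  So at the
places of `S₀` (base-point component `w₀`, level divisible by every `w ∣ v`) the witness's local weight is the INDICATOR of the valuation ball — ★ p864821's `hωS₀` bytes up to the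
identification «valuation ball ⊆ `𝒪_v³`», which needs `|𝔫|_w ≤ |2δ|_w` at `w ∣ v ∣ 2δ` (the (V) keeper's `𝔫` absorbs `2δ·∏_{S₀} 𝔭_w`; next file).
* §1 `apply_diag_ne_zero_of_blockTriangular`, **`finLevelSection_apply_eq_finprod_of_local`** («on»), **`finLevelSection_apply_eq_zero_of_local_off`** («off»).
* §2 **`hΩ_of_localReadings`** — ★ p864821's `hΩ` shape for any family `U` and weights `ω`, from per-place readings.
* §3 **`localReading_on_of_lowerUnitriangular`**, **`localReading_off_of_lowerUnitriangular`** (★ (E-cell) inside the unitary factor `U(2,1)(L⁺_v) ≤ Π_{w∣v} GL₃(L_w)`).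
WHAT THIS FILE DOES NOT DO (census items (a)–(e), each its own file): the per-place MATRIX reading of the finite big-cell element `(ι(w₀)·u(X,θ s))_f·b₁` (entries of `evalPlace`), the
good-place readings (inert: ★ `exists_torusEntry_iwasawa_letters`; split: transport `U(2,1)(L⁺_v) ≅ GL₃(L_w)` + ★ `exists_iwasawa_torusEntries_split`) which feed ★ `hin_of_torusEntries` ∕
`hsp_of_torusEntries`, and the `χ₂ = ξ.ψ` torus factor of the pair block — so ★ p864821's HEAD is letter-free only after those; this file is the assembly they all plug into.
HONEST LABEL: HC_CM is proved only modulo the 7 printed citations (2 remaining named inputs: hLiu418 = `stmt-HodgeConjecture-24832`, h413 = `stmt-HodgeConjecture-24833`) until rung 0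
closes; REL ≠ ★ ≠ BUILT; unconditional restricted-product ∕ valuation plumbing; asserts no named fact, closes no socket; count-neutral.

## References
* [BorelJacquet1979] A. Borel, H. Jacquet, *Automorphic forms and automorphic representations*, Proc. Symp. Pure Math. 33.1 (1979), §4.1.
* [PlatonovRapinchuk1994] V. Platonov, A. Rapinchuk, *Algebraic Groups and Number Theory* (1994), §5.1.
* [TateThesis1967] J. Tate, *Fourier analysis in number fields and Hecke's zeta-functions*, in Cassels–Fröhlich (1967), §3.2 Lemma 3.2.1, §4.3.
* [MoeglinWaldspurger1995] C. Mœglin, J.-L. Waldspurger, *Spectral Decomposition and Eisenstein Series* (1995), I.2.17, II.1.6.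
* [BushnellHenniart2006] C. J. Bushnell, G. Henniart, *The Local Langlands Conjecture for GL(2)* (2006), §7.1, §12.4.
-/

set_option autoImplicit false
set_option linter.dupNamespace false  -- the mandated namespace repeats the summit's segment (`HodgeConjecture.HodgeConjecture`)

noncomputable section

open NumberField IsDedekindDomain Filter Set Function
open Literature.NumberTheory.GaloisRepresentations Literature.NumberTheory.GaloisRepresentations.HeckeCharacter
open Literature.NumberTheory.Automorphic Literature.NumberTheory.Automorphic.UnitaryGroup AdelicGroupData
open Literature.NumberTheory.Automorphic.Arthur2013.Leaves.TECR
open Summit.HodgeConjecture.HodgeConjecture.Cruxes.H413.K2E1CharacterEisensteinU2Defs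
open Summit.HodgeConjecture.HodgeConjecture.Cruxes.H413.K2E1CharacterEisensteinU3PairDefs
open Summit.HodgeConjecture.HodgeConjecture.Cruxes.H413.K2E1FinAdelicBorelLevelLocalGlobalU3 (exists_borel_mul_level_evalPlace_eq forall_ne_borel_mul_level_iff_exists_place)
open Summit.HodgeConjecture.HodgeConjecture.Cruxes.H413.K2E1ChiBorelCharacterLocalFactorisationU3 (borelCharacter_finAdelicToAdelic_eq_finprod_of_apply_eq)
open Summit.HodgeConjecture.HodgeConjecture.Cruxes.H413.K2E1BigCellConjugateCongruenceU3 (lowerUnitriangular_mem_valuedCongruenceSubgroup valuation_le_of_upperTriangular_mul_lowerUnitriangular_mem)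

namespace Summit.HodgeConjecture.HodgeConjecture.Cruxes.H413.K2E1ChiMidBlockUnfoldingLetterFreeU3

/-! ## §1 The finite-level section read on ANY point from local Iwasawa data -/

section Assembly

variable (L : Type) [Field L] [NumberField L] [IsCMField L]

omit [NumberField L] [IsCMField L] in
/-- **An invertible upper-triangular matrix has non-zero diagonal entries** (`det = ∏` of the diagonal, ★ `Matrix.det_of_upperTriangular`; the determinant of a unit is non-zero). [folklore] -/
theorem apply_diag_ne_zero_of_blockTriangular {K : Type*} [Field K] {n : ℕ} {M : GL (Fin n) K} (hM : (M : Matrix (Fin n) (Fin n) K).BlockTriangular id) (i : Fin n) :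
    (M : Matrix (Fin n) (Fin n) K) i i ≠ 0 := by
  have hdet : (M : Matrix (Fin n) (Fin n) K).det ≠ 0 := Matrix.GeneralLinearGroup.det_ne_zero M
  rw [Matrix.det_of_upperTriangular hM] at hdet
  exact (Finset.prod_ne_zero_iff.1 hdet) i (Finset.mem_univ i)

/-- **«ON»: THE FINITE-LEVEL SECTION READ ON ANY POINT FROM LOCAL IWASAWA DATA** ((3)(i) ∘ ★ (3)(ii) ∘ ★ (3)(iii)).  Let `Φ_f` satisfy the (supp-on) clause of ★ (E-supp) for the block `(χ₁, 1)`
at the principal level `K_f(𝔫)`.  If `u ∈ U(2,1)(𝔸_{L⁺,f})` has, at EVERY finite place `v` of `L⁺`, local Iwasawa data `u_v = β_v·κ_v` (`β_v` upper triangular at every `w ∣ v`,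
`(κ_v)_w ∈ K_w(|𝔫|_w)`), and `t_v(w) ∈ L_w^×` are the local `(0,0)`-entries `((β_v)_w)₀₀`, then **`Φ_f(u) = ∏ᶠ_v ∏_{w ∣ v} χ₁,w(t_v(w))`**: ★ `exists_borel_mul_level_evalPlace_eq` assembles global
`b, k` with `b_v = β_v`, (supp-on) reads `Φ_f(u) = χ₁((ι_f b)₀₀)`, ★ `borelCharacter_finAdelicToAdelic_eq_finprod_of_apply_eq` factorises it at the prescribed local entries.
[cite: PlatonovRapinchuk1994, §5.1] [cite: TateThesis1967, §3.2 Lemma 3.2.1, §4.3] [cite: BorelJacquet1979, §4.1] -/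
theorem finLevelSection_apply_eq_finprod_of_local (χ₁ : HeckeCharacter L) (𝔫 : Ideal (𝓞 L))
    (Φf : ↥(finAdelic (↥(maximalRealSubfield L)) L (IsCMField.complexConj L) 3 ((StdForm.antidiagonal 3).over L)) → ℂ)
    (hon : ∀ (b k : ↥(finAdelic (↥(maximalRealSubfield L)) L (IsCMField.complexConj L) 3 ((StdForm.antidiagonal 3).over L)))
        (hb : finAdelicToAdelic (↥(maximalRealSubfield L)) L (IsCMField.complexConj L) 3 ((StdForm.antidiagonal 3).over L) b ∈ borelAdelic (↥(maximalRealSubfield L)) L (IsCMField.complexConj L) 3),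
        k ∈ finCongruenceLevel (↥(maximalRealSubfield L)) L (IsCMField.complexConj L) 3 ((StdForm.antidiagonal 3).over L) 𝔫 →
        Φf (b * k) = ((χ₁ (firstEntryUnit hb) : ℂˣ) : ℂ) * (((1 : ↥(TorusDict.torus (IsCMField.complexConj L)) →ₜ* ℂˣ) (middleEntryUnitary hb) : ℂˣ) : ℂ))
    (u : ↥(finAdelic (↥(maximalRealSubfield L)) L (IsCMField.complexConj L) 3 ((StdForm.antidiagonal 3).over L)))
    (β κ : ∀ v : HeightOneSpectrum (𝓞 ↥(maximalRealSubfield L)), localPi L (IsCMField.complexConj L) 3 ((StdForm.antidiagonal 3).over L) v)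
    (hβ : ∀ (v : HeightOneSpectrum (𝓞 ↥(maximalRealSubfield L))) (w : PlacesOver L v), ((((β v : localPi L (IsCMField.complexConj L) 3 ((StdForm.antidiagonal 3).over L) v) : LocalGLPi L 3 v) w :
        GL (Fin 3) (w.1.adicCompletion L)) : Matrix (Fin 3) (Fin 3) (w.1.adicCompletion L)).BlockTriangular id)
    (hκ : ∀ (v : HeightOneSpectrum (𝓞 ↥(maximalRealSubfield L))) (w : PlacesOver L v), ((κ v : localPi L (IsCMField.complexConj L) 3 ((StdForm.antidiagonal 3).over L) v) : LocalGLPi L 3 v) w ∈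
        valuedCongruenceSubgroup (Fin 3) (idealRadius L w.1 𝔫))
    (hu : ∀ v : HeightOneSpectrum (𝓞 ↥(maximalRealSubfield L)), evalPlace (↥(maximalRealSubfield L)) L (IsCMField.complexConj L) 3 ((StdForm.antidiagonal 3).over L) v u = β v * κ v)
    (t : ∀ (v : HeightOneSpectrum (𝓞 ↥(maximalRealSubfield L))) (w : PlacesOver L v), (w.1.adicCompletion L)ˣ)
    (ht : ∀ (v : HeightOneSpectrum (𝓞 ↥(maximalRealSubfield L))) (w : PlacesOver L v), ((t v w : (w.1.adicCompletion L)ˣ) : w.1.adicCompletion L) =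
        ((((β v : localPi L (IsCMField.complexConj L) 3 ((StdForm.antidiagonal 3).over L) v) : LocalGLPi L 3 v) w : GL (Fin 3) (w.1.adicCompletion L)) : Matrix (Fin 3) (Fin 3) (w.1.adicCompletion L)) 0 0) :
    Φf u = ∏ᶠ v : HeightOneSpectrum (𝓞 ↥(maximalRealSubfield L)), ∏ w : PlacesOver L v, ((χ₁.localComponent w.1 (t v w) : ℂˣ) : ℂ) := by
  obtain ⟨b, k, hb, hk, hbk, hbv, -⟩ :=
    exists_borel_mul_level_evalPlace_eq (↥(maximalRealSubfield L)) L (IsCMField.complexConj L) 3 𝔫 u β κ hβ hκ hu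
  rw [hbk, hon b k hb hk]
  -- ★ (3)(iii) at the prescribed local `(0,0)`-entries `zloc w := t (w ∩ L⁺) w`
  have key := borelCharacter_finAdelicToAdelic_eq_finprod_of_apply_eq L χ₁ b hb
    (fun w => t (w.under (𝓞 ↥(maximalRealSubfield L))) ⟨w, rfl⟩) (fun w => by
      rw [ht, ← hbv (w.under (𝓞 ↥(maximalRealSubfield L))),
        coe_evalPlace_apply (↥(maximalRealSubfield L)) L (IsCMField.complexConj L) 3 ((StdForm.antidiagonal 3).over L) (w.under (𝓞 ↥(maximalRealSubfield L))) b ⟨w, rfl⟩,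
        GLn.coe_evalAt_apply])
  rw [key]
  refine finprod_congr fun v => Finset.prod_congr rfl fun w _ => ?_
  obtain ⟨w, rfl⟩ := w
  rfl

/-- **«OFF»: THE FINITE-LEVEL SECTION VANISHES AT A POINT WITH ONE BAD LOCAL COMPONENT.**  Let `Φ_f` satisfy the (supp-off) clause of ★ (E-supp) at level `K_f(𝔫)`.  If at SOME finite place `v`
of `L⁺` the component `u_v` lies off `B_v·K_v(𝔫)` (no `β` upper triangular at every `w ∣ v` and `κ` with `κ_w ∈ K_w(|𝔫|_w)` give `u_v = β·κ`), then `u ∉ B_f·K_f(𝔫)` (★ (3)(ii)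
`forall_ne_borel_mul_level_iff_exists_place`) and **`Φ_f(u) = 0`**. [cite: PlatonovRapinchuk1994, §5.1] [cite: BorelJacquet1979, §4.1] -/
theorem finLevelSection_apply_eq_zero_of_local_off (𝔫 : Ideal (𝓞 L))
    (Φf : ↥(finAdelic (↥(maximalRealSubfield L)) L (IsCMField.complexConj L) 3 ((StdForm.antidiagonal 3).over L)) → ℂ)
    (hoff : ∀ u : ↥(finAdelic (↥(maximalRealSubfield L)) L (IsCMField.complexConj L) 3 ((StdForm.antidiagonal 3).over L)),
      (∀ (b k : ↥(finAdelic (↥(maximalRealSubfield L)) L (IsCMField.complexConj L) 3 ((StdForm.antidiagonal 3).over L))),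
          finAdelicToAdelic (↥(maximalRealSubfield L)) L (IsCMField.complexConj L) 3 ((StdForm.antidiagonal 3).over L) b ∈ borelAdelic (↥(maximalRealSubfield L)) L (IsCMField.complexConj L) 3 →
            k ∈ finCongruenceLevel (↥(maximalRealSubfield L)) L (IsCMField.complexConj L) 3 ((StdForm.antidiagonal 3).over L) 𝔫 → u ≠ b * k) → Φf u = 0)
    (u : ↥(finAdelic (↥(maximalRealSubfield L)) L (IsCMField.complexConj L) 3 ((StdForm.antidiagonal 3).over L)))
    {v : HeightOneSpectrum (𝓞 ↥(maximalRealSubfield L))}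
    (hv : ∀ β κ : localPi L (IsCMField.complexConj L) 3 ((StdForm.antidiagonal 3).over L) v,
      (∀ w : PlacesOver L v, ((((β : localPi L (IsCMField.complexConj L) 3 ((StdForm.antidiagonal 3).over L) v) : LocalGLPi L 3 v) w : GL (Fin 3) (w.1.adicCompletion L)) :
        Matrix (Fin 3) (Fin 3) (w.1.adicCompletion L)).BlockTriangular id) →
      (∀ w : PlacesOver L v, ((κ : localPi L (IsCMField.complexConj L) 3 ((StdForm.antidiagonal 3).over L) v) : LocalGLPi L 3 v) w ∈ valuedCongruenceSubgroup (Fin 3) (idealRadius L w.1 𝔫)) →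
      evalPlace (↥(maximalRealSubfield L)) L (IsCMField.complexConj L) 3 ((StdForm.antidiagonal 3).over L) v u ≠ β * κ) :
    Φf u = 0 :=
  hoff u ((forall_ne_borel_mul_level_iff_exists_place (↥(maximalRealSubfield L)) L (IsCMField.complexConj L) 3 𝔫 u).2 ⟨v, hv⟩)

/-! ## §2 ★ p864821's letter `hΩ` from per-place readings -/

/-- **THE PURE-TENSOR READING FROM PER-PLACE READINGS** (★ p864821's `hΩ` shape).  Let `Φ_f` satisfy (supp-on) and (supp-off) of ★ (E-supp) for the block `(χ₁, 1)` at level `K_f(𝔫)`, let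
`x ↦ U(x) ∈ U(2,1)(𝔸_{L⁺,f})` be any family indexed by `x : (𝔸_{L⁺,f})³` and `ω_v : (L⁺_v)³ → ℂ` any local weights.  Suppose that for every `x` and every finite place `v` of `L⁺` EITHER
(on) `U(x)_v = β·κ` with `β` upper triangular at every `w ∣ v`, `κ_w ∈ K_w(|𝔫|_w)`, and `ω_v(x_v) = ∏_{w ∣ v} χ₁,w(t_w)` for local units `t_w = (β_w)₀₀`, OR (off) `U(x)_v ∉ B_v·K_v(𝔫)`,
`ω_v(x_v) = 0` and only finitely many `ω_{v'}(x_{v'}) ≠ 1`.  THEN **`∀ x, Φ_f(U x) = ∏ᶠ_v ω_v(x_v)`** (§1 «on» with the readings chosen at every place, resp. §1 «off» and ★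
`finprod_eq_zero`).  With `U x := (ι(w₀)·u((0,X_f(x)),θ(0,x₂)))_f·b₁` this is ★ p864821's `hΩ` byte for byte; with `·k_f`, K2E1-p14's `hΩ_k`.
[cite: PlatonovRapinchuk1994, §5.1] [cite: TateThesis1967, §4.3] [cite: MoeglinWaldspurger1995, I.2.17, II.1.6] -/
theorem hΩ_of_localReadings (χ₁ : HeckeCharacter L) (𝔫 : Ideal (𝓞 L))
    (Φf : ↥(finAdelic (↥(maximalRealSubfield L)) L (IsCMField.complexConj L) 3 ((StdForm.antidiagonal 3).over L)) → ℂ)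
    (hon : ∀ (b k : ↥(finAdelic (↥(maximalRealSubfield L)) L (IsCMField.complexConj L) 3 ((StdForm.antidiagonal 3).over L)))
        (hb : finAdelicToAdelic (↥(maximalRealSubfield L)) L (IsCMField.complexConj L) 3 ((StdForm.antidiagonal 3).over L) b ∈ borelAdelic (↥(maximalRealSubfield L)) L (IsCMField.complexConj L) 3),
        k ∈ finCongruenceLevel (↥(maximalRealSubfield L)) L (IsCMField.complexConj L) 3 ((StdForm.antidiagonal 3).over L) 𝔫 →
        Φf (b * k) = ((χ₁ (firstEntryUnit hb) : ℂˣ) : ℂ) * (((1 : ↥(TorusDict.torus (IsCMField.complexConj L)) →ₜ* ℂˣ) (middleEntryUnitary hb) : ℂˣ) : ℂ))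
    (hoff : ∀ u : ↥(finAdelic (↥(maximalRealSubfield L)) L (IsCMField.complexConj L) 3 ((StdForm.antidiagonal 3).over L)),
      (∀ (b k : ↥(finAdelic (↥(maximalRealSubfield L)) L (IsCMField.complexConj L) 3 ((StdForm.antidiagonal 3).over L))),
          finAdelicToAdelic (↥(maximalRealSubfield L)) L (IsCMField.complexConj L) 3 ((StdForm.antidiagonal 3).over L) b ∈ borelAdelic (↥(maximalRealSubfield L)) L (IsCMField.complexConj L) 3 →
            k ∈ finCongruenceLevel (↥(maximalRealSubfield L)) L (IsCMField.complexConj L) 3 ((StdForm.antidiagonal 3).over L) 𝔫 → u ≠ b * k) → Φf u = 0)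
    (U : (Fin 3 → FiniteAdeleRing (𝓞 ↥(maximalRealSubfield L)) ↥(maximalRealSubfield L)) → ↥(finAdelic (↥(maximalRealSubfield L)) L (IsCMField.complexConj L) 3 ((StdForm.antidiagonal 3).over L)))
    (ω : ∀ v : HeightOneSpectrum (𝓞 ↥(maximalRealSubfield L)), (Fin 3 → v.adicCompletion ↥(maximalRealSubfield L)) → ℂ)
    (hread : ∀ (x : Fin 3 → FiniteAdeleRing (𝓞 ↥(maximalRealSubfield L)) ↥(maximalRealSubfield L)) (v : HeightOneSpectrum (𝓞 ↥(maximalRealSubfield L))),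
      (∃ (β κ : localPi L (IsCMField.complexConj L) 3 ((StdForm.antidiagonal 3).over L) v) (t : ∀ w : PlacesOver L v, (w.1.adicCompletion L)ˣ),
        (∀ w : PlacesOver L v, ((((β : localPi L (IsCMField.complexConj L) 3 ((StdForm.antidiagonal 3).over L) v) : LocalGLPi L 3 v) w : GL (Fin 3) (w.1.adicCompletion L)) :
          Matrix (Fin 3) (Fin 3) (w.1.adicCompletion L)).BlockTriangular id) ∧
        (∀ w : PlacesOver L v, ((κ : localPi L (IsCMField.complexConj L) 3 ((StdForm.antidiagonal 3).over L) v) : LocalGLPi L 3 v) w ∈ valuedCongruenceSubgroup (Fin 3) (idealRadius L w.1 𝔫)) ∧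
        evalPlace (↥(maximalRealSubfield L)) L (IsCMField.complexConj L) 3 ((StdForm.antidiagonal 3).over L) v (U x) = β * κ ∧
        (∀ w : PlacesOver L v, ((t w : (w.1.adicCompletion L)ˣ) : w.1.adicCompletion L) =
          ((((β : localPi L (IsCMField.complexConj L) 3 ((StdForm.antidiagonal 3).over L) v) : LocalGLPi L 3 v) w : GL (Fin 3) (w.1.adicCompletion L)) : Matrix (Fin 3) (Fin 3) (w.1.adicCompletion L)) 0 0) ∧
        ω v (fun i => x i v) = ∏ w : PlacesOver L v, ((χ₁.localComponent w.1 (t w) : ℂˣ) : ℂ)) ∨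
      ((∀ β κ : localPi L (IsCMField.complexConj L) 3 ((StdForm.antidiagonal 3).over L) v,
        (∀ w : PlacesOver L v, ((((β : localPi L (IsCMField.complexConj L) 3 ((StdForm.antidiagonal 3).over L) v) : LocalGLPi L 3 v) w : GL (Fin 3) (w.1.adicCompletion L)) :
          Matrix (Fin 3) (Fin 3) (w.1.adicCompletion L)).BlockTriangular id) →
        (∀ w : PlacesOver L v, ((κ : localPi L (IsCMField.complexConj L) 3 ((StdForm.antidiagonal 3).over L) v) : LocalGLPi L 3 v) w ∈ valuedCongruenceSubgroup (Fin 3) (idealRadius L w.1 𝔫)) →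
        evalPlace (↥(maximalRealSubfield L)) L (IsCMField.complexConj L) 3 ((StdForm.antidiagonal 3).over L) v (U x) ≠ β * κ) ∧
        ω v (fun i => x i v) = 0 ∧ (mulSupport fun v' : HeightOneSpectrum (𝓞 ↥(maximalRealSubfield L)) => ω v' (fun i => x i v')).Finite)) :
    ∀ x : Fin 3 → FiniteAdeleRing (𝓞 ↥(maximalRealSubfield L)) ↥(maximalRealSubfield L),
      Φf (U x) = ∏ᶠ v : HeightOneSpectrum (𝓞 ↥(maximalRealSubfield L)), ω v (fun i => x i v) := by
  intro x
  by_cases hall : ∀ v : HeightOneSpectrum (𝓞 ↥(maximalRealSubfield L)),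
      ∃ (β κ : localPi L (IsCMField.complexConj L) 3 ((StdForm.antidiagonal 3).over L) v) (t : ∀ w : PlacesOver L v, (w.1.adicCompletion L)ˣ),
        (∀ w : PlacesOver L v, ((((β : localPi L (IsCMField.complexConj L) 3 ((StdForm.antidiagonal 3).over L) v) : LocalGLPi L 3 v) w : GL (Fin 3) (w.1.adicCompletion L)) :
          Matrix (Fin 3) (Fin 3) (w.1.adicCompletion L)).BlockTriangular id) ∧
        (∀ w : PlacesOver L v, ((κ : localPi L (IsCMField.complexConj L) 3 ((StdForm.antidiagonal 3).over L) v) : LocalGLPi L 3 v) w ∈ valuedCongruenceSubgroup (Fin 3) (idealRadius L w.1 𝔫)) ∧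
        evalPlace (↥(maximalRealSubfield L)) L (IsCMField.complexConj L) 3 ((StdForm.antidiagonal 3).over L) v (U x) = β * κ ∧
        (∀ w : PlacesOver L v, ((t w : (w.1.adicCompletion L)ˣ) : w.1.adicCompletion L) =
          ((((β : localPi L (IsCMField.complexConj L) 3 ((StdForm.antidiagonal 3).over L) v) : LocalGLPi L 3 v) w : GL (Fin 3) (w.1.adicCompletion L)) : Matrix (Fin 3) (Fin 3) (w.1.adicCompletion L)) 0 0) ∧
        ω v (fun i => x i v) = ∏ w : PlacesOver L v, ((χ₁.localComponent w.1 (t w) : ℂˣ) : ℂ)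
  · -- «on» at every place: choose the readings and assemble
    choose β κ t hβ hκ hu ht hω using hall
    rw [finLevelSection_apply_eq_finprod_of_local L χ₁ 𝔫 Φf hon (U x) β κ hβ hκ hu t ht]
    exact finprod_congr fun v => (hω v).symm
  · -- «off» at some place `v₀`: both sides vanish
    obtain ⟨v₀, hv₀⟩ := not_forall.1 hall
    obtain ⟨hoffv, hω0, hfin⟩ := (hread x v₀).resolve_left hv₀
    rw [finLevelSection_apply_eq_zero_of_local_off L 𝔫 Φf hoff (U x) hoffv]
    exact (finprod_eq_zero (fun v' => ω v' (fun i => x i v')) v₀ hω0 hfin).symm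

end Assembly

/-! ## §3 The bad-place local reading: a lower unitriangular component, through ★ (E-cell) -/

section BadPlace

variable (L : Type) [Field L] [NumberField L] [IsCMField L]

/-- **BAD-PLACE «ON» READING.**  If every `w`-component of `g ∈ U(2,1)(L⁺_v)` is LOWER UNITRIANGULAR `(1 0 0; a_w 1 0; b_w d_w 1)` with `|a_w|, |b_w|, |d_w| ≤ |𝔫|_w < 1`, then `g` itself lies
in `K_v(𝔫)` (★ (E-cell) «⇐» at every `w ∣ v`), so the «on» reading of §2 holds WITH `β = 1`, `κ = g`, `t_w = 1` — and the local character factor is `∏_{w∣v} χ_w(1) = 1`.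
[cite: BushnellHenniart2006, §12.4] [cite: Rogawski1990, §4.5 p. 45] -/
theorem localReading_on_of_lowerUnitriangular (𝔫 : Ideal (𝓞 L)) {v : HeightOneSpectrum (𝓞 ↥(maximalRealSubfield L))}
    (g : localPi L (IsCMField.complexConj L) 3 ((StdForm.antidiagonal 3).over L) v)
    (a b d : ∀ w : PlacesOver L v, w.1.adicCompletion L)
    (hg : ∀ w : PlacesOver L v, ((((g : localPi L (IsCMField.complexConj L) 3 ((StdForm.antidiagonal 3).over L) v) : LocalGLPi L 3 v) w : GL (Fin 3) (w.1.adicCompletion L)) :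
        Matrix (Fin 3) (Fin 3) (w.1.adicCompletion L)) = !![1, 0, 0; a w, 1, 0; b w, d w, 1])
    (h𝔫 : ∀ w : PlacesOver L v, idealRadius L w.1 𝔫 < 1)
    (hball : ∀ w : PlacesOver L v, Valued.v (a w) ≤ idealRadius L w.1 𝔫 ∧ Valued.v (b w) ≤ idealRadius L w.1 𝔫 ∧ Valued.v (d w) ≤ idealRadius L w.1 𝔫) :
    (∀ w : PlacesOver L v, ((((1 : localPi L (IsCMField.complexConj L) 3 ((StdForm.antidiagonal 3).over L) v) : LocalGLPi L 3 v) w : GL (Fin 3) (w.1.adicCompletion L)) :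
        Matrix (Fin 3) (Fin 3) (w.1.adicCompletion L)).BlockTriangular id) ∧
    (∀ w : PlacesOver L v, ((g : localPi L (IsCMField.complexConj L) 3 ((StdForm.antidiagonal 3).over L) v) : LocalGLPi L 3 v) w ∈ valuedCongruenceSubgroup (Fin 3) (idealRadius L w.1 𝔫)) ∧
    g = 1 * g ∧
    (∀ w : PlacesOver L v, (((1 : (w.1.adicCompletion L)ˣ) : (w.1.adicCompletion L)ˣ) : w.1.adicCompletion L) =
        ((((1 : localPi L (IsCMField.complexConj L) 3 ((StdForm.antidiagonal 3).over L) v) : LocalGLPi L 3 v) w : GL (Fin 3) (w.1.adicCompletion L)) : Matrix (Fin 3) (Fin 3) (w.1.adicCompletion L)) 0 0) ∧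
    (∀ χw : ∀ w : PlacesOver L v, (w.1.adicCompletion L)ˣ →* ℂˣ, ∏ w : PlacesOver L v, ((χw w (1 : (w.1.adicCompletion L)ˣ) : ℂˣ) : ℂ) = 1) := by
  refine ⟨fun w => ?_, fun w => lowerUnitriangular_mem_valuedCongruenceSubgroup (h𝔫 w) (hball w).1 (hball w).2.1 (hball w).2.2 (hg w), (one_mul g).symm, fun w => ?_, fun χw => ?_⟩
  · rw [OneMemClass.coe_one, Pi.one_apply, Units.val_one]
    exact Matrix.blockTriangular_one
  · rw [OneMemClass.coe_one, Pi.one_apply, Units.val_one, Units.val_one, Matrix.one_apply_eq]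
  · exact Finset.prod_eq_one fun w _ => by rw [map_one, Units.val_one]

/-- **BAD-PLACE «OFF» READING.**  If every `w`-component of `g ∈ U(2,1)(L⁺_v)` is lower unitriangular `(1 0 0; a_w 1 0; b_w d_w 1)`, `|𝔫|_w < 1` at every `w ∣ v`, and at SOME `w₁ ∣ v` one of
`|a_{w₁}|, |b_{w₁}|, |d_{w₁}|` exceeds `|𝔫|_{w₁}`, then `g ∉ B_v·K_v(𝔫)`: from `g = β·κ` one gets `β_{w₁}⁻¹·g_{w₁} = κ_{w₁} ∈ K_{w₁}(|𝔫|_{w₁})` with `β_{w₁}⁻¹` upper triangular, and ★ (E-cell) «⇒»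
bounds the three valuations — contradiction. [cite: BushnellHenniart2006, §7.1, §12.4] [cite: Rogawski1990, §4.5 p. 45] -/
theorem localReading_off_of_lowerUnitriangular (𝔫 : Ideal (𝓞 L)) {v : HeightOneSpectrum (𝓞 ↥(maximalRealSubfield L))}
    (g : localPi L (IsCMField.complexConj L) 3 ((StdForm.antidiagonal 3).over L) v)
    (a b d : ∀ w : PlacesOver L v, w.1.adicCompletion L)
    (hg : ∀ w : PlacesOver L v, ((((g : localPi L (IsCMField.complexConj L) 3 ((StdForm.antidiagonal 3).over L) v) : LocalGLPi L 3 v) w : GL (Fin 3) (w.1.adicCompletion L)) :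
        Matrix (Fin 3) (Fin 3) (w.1.adicCompletion L)) = !![1, 0, 0; a w, 1, 0; b w, d w, 1])
    (h𝔫 : ∀ w : PlacesOver L v, idealRadius L w.1 𝔫 < 1)
    {w₁ : PlacesOver L v} (hoff : ¬ (Valued.v (a w₁) ≤ idealRadius L w₁.1 𝔫 ∧ Valued.v (b w₁) ≤ idealRadius L w₁.1 𝔫 ∧ Valued.v (d w₁) ≤ idealRadius L w₁.1 𝔫)) :
    ∀ β κ : localPi L (IsCMField.complexConj L) 3 ((StdForm.antidiagonal 3).over L) v,
      (∀ w : PlacesOver L v, ((((β : localPi L (IsCMField.complexConj L) 3 ((StdForm.antidiagonal 3).over L) v) : LocalGLPi L 3 v) w : GL (Fin 3) (w.1.adicCompletion L)) :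
        Matrix (Fin 3) (Fin 3) (w.1.adicCompletion L)).BlockTriangular id) →
      (∀ w : PlacesOver L v, ((κ : localPi L (IsCMField.complexConj L) 3 ((StdForm.antidiagonal 3).over L) v) : LocalGLPi L 3 v) w ∈ valuedCongruenceSubgroup (Fin 3) (idealRadius L w.1 𝔫)) →
      g ≠ β * κ := by
  intro β κ hβ hκ hgβκ
  apply hoff
  -- at `w₁`: `β_{w₁}⁻¹ · g_{w₁} = κ_{w₁} ∈ K_{w₁}(|𝔫|_{w₁})`, `β_{w₁}⁻¹` upper triangular
  have hcomp : ((g : localPi L (IsCMField.complexConj L) 3 ((StdForm.antidiagonal 3).over L) v) : LocalGLPi L 3 v) w₁ =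
      ((β : localPi L (IsCMField.complexConj L) 3 ((StdForm.antidiagonal 3).over L) v) : LocalGLPi L 3 v) w₁ *
        ((κ : localPi L (IsCMField.complexConj L) 3 ((StdForm.antidiagonal 3).over L) v) : LocalGLPi L 3 v) w₁ := by
    rw [hgβκ, Subgroup.coe_mul, Pi.mul_apply]
  have hinvBT : (((((β : localPi L (IsCMField.complexConj L) 3 ((StdForm.antidiagonal 3).over L) v) : LocalGLPi L 3 v) w₁)⁻¹ : GL (Fin 3) (w₁.1.adicCompletion L)) :
      Matrix (Fin 3) (Fin 3) (w₁.1.adicCompletion L)).BlockTriangular id := by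
    rw [Matrix.coe_units_inv]
    exact Matrix.blockTriangular_inv_of_blockTriangular (hβ w₁)
  refine valuation_le_of_upperTriangular_mul_lowerUnitriangular_mem (h𝔫 w₁) (hg w₁) hinvBT ?_
  rw [hcomp, inv_mul_cancel_left]
  exact hκ w₁

end BadPlace

end Summit.HodgeConjecture.HodgeConjecture.Cruxes.H413.K2E1ChiMidBlockUnfoldingLetterFreeU3

end
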